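import Summits.BirchSwinnertonDyer.BirchSwinnertonDyer.Theorems.AdditiveKolyvaginRoadLevelKolyvaginSystemsAdditiveTwinRise
import Summits.BirchSwinnertonDyer.BirchSwinnertonDyer.Theorems.AdditiveKolyvaginRoadLevelKolyvaginSystemsAdditiveTwinJump
import Summits.BirchSwinnertonDyer.BirchSwinnertonDyer.Theorems.AdditiveKolyvaginRoadKolyvaginAxisLemma
import HarnessLib

/-!
# Route `AdditiveKolyvaginRoad`, crux KS′ `LevelKolyvaginSystemsAdditive` (item stmt-BirchSwinnertonDyer-21396):
# the LOCAL TRICHOTOMY at a Kolyvagin prime for the `λ`-relaxed mixed structure — Kummer or TRANSVERSE — and the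
# (Twin) JUMP binder for the mixed Selmer spaces modulo Poitou–Tate alone
# (cell `pub/bsd-wall`, width seat `bsd-wall-akr-p2x-w3` g8; `--supports stmt-BirchSwinnertonDyer-21396`, helper; composes the w3 lineage's
# AXIS LEMMA `…KolyvaginAxisLemma` (p625767) with the w2 lineage's isotropy-at-`λ` `…TwinRise` (p629499) and plugs the result into
# `twinJump_mixed_of_trich` of `…TwinJump` (p628901))

WHY. The (Twin) dichotomy for the mixed spaces `Sel(m, n)^μ` (Howard 2004 Lemma 2.5.3) is displayed in
`nonempty_levelKolyvaginSystemP_of_seed_of_twin` ∕ `levelKolyvaginSystemsAdditive_of_kolyvaginPrimitive_of_twin` as three binders `hDrop`,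
`hRise`, `hJump`. `hDrop` (`twinDrop_mixed`) and `hRise` (`twinRise_mixed`) are tree theorems, Poitou–Tate-free. `hJump` is the tree theorem
`twinJump_mixed_of_trich` GRANTED the local trichotomy TRICH: «a `μ`-eigenclass of the `λ`-relaxed mixed structure (Kummer at `∞` and at the
finite places under no prime of `m ∪ n ∪ {ℓ}`, toric above `n`, transverse above `m`) which is NOT Kummer at the place `λ` of the Kolyvagin prime
`ℓ` is TRANSVERSE at `λ`» (Gross 1991 Prop. 8.1–8.2: the isotropic lines of the hyperbolic eigen-plane `H¹(K_λ, E[p])^μ` are `H¹_f^μ` and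
`H¹_tr^μ`). THIS FILE proves TRICH in the kernel, with NO Poitou–Tate input, by composing two landed theorems:
* the `λ`-relaxed mixed structure is isotropic AT `λ` (`weilCupProduct_eq_zero_at_of_mixedRelaxed`: Tate reciprocity for the totally complex `K`
  plus the vanishing of the local Weil cup products away from `λ` — Kummer ∕ toric ∕ transverse isotropies), so `loc_λ x ∪ₑ loc_λ x = 0`;
* THE LOCAL AXIS LEMMA (`mem_transverseLocalKerP_of_cupProduct_self_eq_zero_P`): at a Kolyvagin prime of the frame an eigenclass not Kummer at
  `λ` with `loc_λ x ∪ₑ loc_λ x = 0` lies in `transverseLocalKerP` (the alternating Weil pairing puts an isotropic vector of the eigen-plane on an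
  axis; Gross's Frobenius lift fixes `K[ℓ]`).

WHAT.
* §1 `mem_transverseLocalKerP_of_mixedRelaxed` — TRICH, literally the hypothesis `htrich` of `twinJump_mixed_of_trich` (frame: `K` imaginary
  quadratic with `d_K < −4`, `p` odd, `ρ̄_{E,p}` onto, `c ≠ 1`; any reduction type at `p`). Poitou–Tate-FREE.
* §2 `twinJump_mixed_of_poitouTate` — the (Twin) JUMP binder `hJump` for the mixed spaces VERBATIM, from the Poitou–Tate fact alone
  (`twinJump_mixed_of_trich` ∘ §1); `twinJump_mixed_of_poitouTate'` — the same with the local `ZMod p`-structures supplied in the kernel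
  (tree recipe `AddCommGroup.zmodModule`), so that a by-name capstone can call it with the frame data alone.

NET for crux KS′: with `twinDrop_mixed` ✓ and `twinRise_mixed` ✓ the (Twin) input of `levelKolyvaginSystemsAdditive_of_kolyvaginPrimitive_of_twin`
is a theorem modulo `poitouTate_selmerStructure_duality K` (= DUAL.2 of the route), i.e. the E-side of «KS′ ⟸ KPA′ + PUB + DUAL» is closed through
the (Twin) door. HONEST FRAMING: theorems only; 0 definitions, 0 named facts, 0 `sorry`; §2 is CONDITIONAL on the Poitou–Tate fact (hypothesis).
Closes nothing by itself. BSD is not proved by any of this; KS′ and KPA′ are OPEN.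

References: [cite: GrossLMS1991, Prop. 8.1, Prop. 8.2, Prop. 9.6] [cite: Howard2004HeegnerKolyvagin, Lemma 2.5.3, Lemma 2.5.6]
[cite: WZhang2014, Lemma 8.2, Lemma 8.4, §8.1] [cite: McCallumLMS1991, Lemma 5.3] [cite: MazurRubin2004, Lemma 4.1.7]
[cite: MilneADT2006, Ch. I, Thm. 4.10].
-/

set_option linter.dupNamespace false -- single-conjunct summit repeats the name by design

noncomputable section

open scoped Classical

namespace Summit.BirchSwinnertonDyer.BirchSwinnertonDyer.Theorems.AdditiveKoly

open CategoryTheory WeierstrassCurve Field Function NumberField IsDedekindDomain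
open Literature.NumberTheory.EllipticCurves Literature.NumberTheory.EllipticCurves.ModularForms
  Literature.NumberTheory.GaloisRepresentations Module
open Literature.NumberTheory.GaloisCohomology
open Summit.BirchSwinnertonDyer.Rank1Residual.X11b.Three.Koly.Method2
open Summit.BirchSwinnertonDyer.Rank1Residual.X11b.Three.Koly
open scoped ContRepresentation

variable (W : WeierstrassCurve ℚ) (K : Type) [Field K] [NumberField K] (p : ℕ) [W.IsElliptic] [W.IsGloballyMinimal]
  [Fact p.Prime] (c : K ≃ₐ[ℚ] K) (ι : K →+* ℂ) [Module (ZMod p) (Vp W K p)]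

/-! ## §1 The local trichotomy at a Kolyvagin prime for the `λ`-relaxed mixed structure (Poitou–Tate-free) -/

omit [Module (ZMod p) (Vp W K p)] in
/-- **TRICH — a class of the `λ`-relaxed mixed structure not Kummer at `λ` is transverse at `λ`.** Frame: `K` imaginary quadratic with
`d_K < −4`, `p` odd, `ρ̄_{E,p}` onto, `c ≠ 1` (any reduction type of `E` at `p`). For a Kolyvagin prime `ℓ` with place `v`, a conductor `m`,
a level `n` and a sign `μ`: a `μ`-eigenclass `x ∈ H¹(K, E[p])` which is Kummer at the infinite places and at the finite places under no prime
of `m ∪ n ∪ {ℓ}`, toric above `n` and transverse above `m`, and which is NOT Kummer at `v`, lies in `transverseLocalKerP W K p ι ℓ v`.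
Proof: the relaxed structure is isotropic at `v` (`weilCupProduct_eq_zero_at_of_mixedRelaxed`, Tate reciprocity), so `loc_v x ∪ₑ loc_v x = 0`
for a Weil pairing `e` (`exists_weilPairing_holds`), and the local axis lemma `mem_transverseLocalKerP_of_cupProduct_self_eq_zero_P` concludes.
This is the hypothesis `htrich` of `twinJump_mixed_of_trich`, verbatim up to its idle `ℓ ∉ m`.
[cite: GrossLMS1991, Prop. 8.1, Prop. 8.2] [cite: Howard2004HeegnerKolyvagin, Lemma 2.5.3] [cite: WZhang2014, §8.1, Lemma 8.4] -/
theorem mem_transverseLocalKerP_of_mixedRelaxed (hK : IsImaginaryQuadratic K) (hp2 : p ≠ 2) (hd : NumberField.discr K < -4)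
    (hsurj : W.HasSurjectiveModNGaloisRep p) (hc : c ≠ 1)
    (m : Finset {ℓ // Zhang2014.IsKolyvaginPrime (W.conductorNorm ℤ) W K p ℓ})
    (ℓ : {ℓ // Zhang2014.IsKolyvaginPrime (W.conductorNorm ℤ) W K p ℓ}) (n : Finset (AdmQ W K p))
    (v : HeightOneSpectrum (𝓞 K)) (μ : Bool) (x : Vp W K p) (hv : ((ℓ : ℕ) : 𝓞 K) ∈ v.asIdeal)
    (hxs : conjAct W c ((p ^ 1 : ℕ) : ℤ) x = sgnP μ • x)
    (hxR : (∀ w : InfinitePlace K, x ∈ selmerLocalKer (W.baseChange K) w.Completion ((p ^ 1 : ℕ) : ℤ)) ∧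
      (∀ w : HeightOneSpectrum (𝓞 K), ((ℓ : ℕ) : 𝓞 K) ∉ w.asIdeal → (∀ ℓ' ∈ m, ((ℓ' : ℕ) : 𝓞 K) ∉ w.asIdeal) →
        (∀ q ∈ n, ((q : ℕ) : 𝓞 K) ∉ w.asIdeal) → x ∈ selmerLocalKer (W.baseChange K) (w.adicCompletion K) ((p ^ 1 : ℕ) : ℤ)) ∧
      (∀ q ∈ n, ∀ w : HeightOneSpectrum (𝓞 K), ((q : ℕ) : 𝓞 K) ∈ w.asIdeal →
        x ∈ toricLocalKer (W.baseChange K) (w.adicCompletion K) ((p ^ 1 : ℕ) : ℤ)) ∧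
      (∀ ℓ' ∈ m, ∀ w : HeightOneSpectrum (𝓞 K), ((ℓ' : ℕ) : 𝓞 K) ∈ w.asIdeal → x ∈ transverseLocalKerP W K p ι ℓ' w))
    (hxK : x ∉ selmerLocalKer (W.baseChange K) (v.adicCompletion K) ((p ^ 1 : ℕ) : ℤ)) :
    x ∈ transverseLocalKerP W K p ι ℓ v := by
  have hp : p.Prime := Fact.out
  haveI : Fact (Nat.Prime (p ^ 1)) := ⟨by rw [pow_one]; exact hp⟩
  haveI : NeZero (p ^ 1 : ℕ) := ⟨pow_ne_zero 1 hp.ne_zero⟩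
  haveI : ∀ w : Place K, CompactSpace (absoluteGaloisGroup (Place.Completion w)) := fun w ↦
    absoluteGaloisGroup_compactSpace _
  haveI : Finite (geomTorsion (W.baseChange K) ((p ^ 1 : ℕ) : ℤ)) :=
    finite_geomTorsion_of_neZero (W.baseChange K) (p ^ 1)
  -- a Weil pairing on `E[p]`
  obtain ⟨e, hμ, hadd₁, hadd₂, halt, hnondeg, hgal⟩ :=
    exists_weilPairing_holds (W.baseChange K) (p ^ 1) (by rw [pow_one]; exact hp.two_le) (by
      rw [pow_one]; exact_mod_cast hp.ne_zero)
  -- isotropy of the `λ`-relaxed mixed structure AT `λ` (Tate reciprocity): `loc_v x ∪ₑ loc_v x = 0`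
  have hxx := weilCupProduct_eq_zero_at_of_mixedRelaxed W K p ι hK hp2 e hμ hadd₁ hadd₂ halt hgal m ℓ n v hv hxR hxR
  -- the local axis lemma
  exact mem_transverseLocalKerP_of_cupProduct_self_eq_zero_P W K p hK hp2 hd hsurj ι hc e hμ hadd₁ hadd₂ halt hnondeg
    hgal ℓ.2 v hv μ hxs hxK hxx

/-! ## §2 The (Twin) JUMP binder for the mixed spaces, modulo Poitou–Tate alone -/

/-- **(Twin), JUMP — the binder `hJump` of `nonempty_levelKolyvaginSystemP_of_seed_of_twin` VERBATIM, from the Poitou–Tate fact alone.**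
Frame: `K` imaginary quadratic with `d_K < −4`, `p` odd, `ρ̄_{E,p}` onto, `c ≠ 1`, Poitou–Tate duality for Selmer structures over `K`; `Mix` the
mixed spaces through their membership dictionary. For a Kolyvagin prime `ℓ ∉ m`, a NON-EMPTY admissible level `n` and a sign `μ`: one of
`Sel(m, n)^μ`, `Sel(mℓ, n)^μ` contains a class NOT locally trivial above `ℓ`. Proof: `twinJump_mixed_of_trich` (W. Zhang Lemma 8.2 signed and
detected, from Poitou–Tate) with TRICH discharged by §1. CONDITIONAL on the named Poitou–Tate fact (hypothesis `hPT`).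
[cite: WZhang2014, Lemma 8.2] [cite: Howard2004HeegnerKolyvagin, Lemma 2.5.3] [cite: GrossLMS1991, Prop. 8.2] -/
theorem twinJump_mixed_of_poitouTate
    [∀ v : Place K, Module (ZMod p) (galoisCohomology (((W.baseChange K).torsionGaloisModule ((p ^ 1 : ℕ) : ℤ)).toLocal v) 1)]
    (hK : IsImaginaryQuadratic K) (hp2 : p ≠ 2) (hd : NumberField.discr K < -4)
    (hsurj : W.HasSurjectiveModNGaloisRep p) (hc : c ≠ 1) (hPT : poitouTate_selmerStructure_duality K)
    (Mix : Finset {ℓ // Zhang2014.IsKolyvaginPrime (W.conductorNorm ℤ) W K p ℓ} → Finset (AdmQ W K p) → Bool → Submodule (ZMod p) (Vp W K p))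
    (hMix : ∀ (m : Finset {ℓ // Zhang2014.IsKolyvaginPrime (W.conductorNorm ℤ) W K p ℓ}) (n : Finset (AdmQ W K p)) (μ : Bool) (x : Vp W K p),
      x ∈ Mix m n μ ↔ (conjAct W c ((p ^ 1 : ℕ) : ℤ) x = sgnP μ • x ∧
        (∀ w : InfinitePlace K, x ∈ selmerLocalKer (W.baseChange K) w.Completion ((p ^ 1 : ℕ) : ℤ)) ∧
        (∀ v : HeightOneSpectrum (𝓞 K), (∀ ℓ ∈ m, ((ℓ : ℕ) : 𝓞 K) ∉ v.asIdeal) → (∀ q ∈ n, ((q : ℕ) : 𝓞 K) ∉ v.asIdeal) →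
          x ∈ selmerLocalKer (W.baseChange K) (v.adicCompletion K) ((p ^ 1 : ℕ) : ℤ)) ∧
        (∀ q ∈ n, ∀ v : HeightOneSpectrum (𝓞 K), ((q : ℕ) : 𝓞 K) ∈ v.asIdeal →
          x ∈ toricLocalKer (W.baseChange K) (v.adicCompletion K) ((p ^ 1 : ℕ) : ℤ)) ∧
        (∀ ℓ ∈ m, ∀ v : HeightOneSpectrum (𝓞 K), ((ℓ : ℕ) : 𝓞 K) ∈ v.asIdeal → x ∈ transverseLocalKerP W K p ι ℓ v))) :
    ∀ (m : Finset {ℓ // Zhang2014.IsKolyvaginPrime (W.conductorNorm ℤ) W K p ℓ})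
      (ℓ : {ℓ // Zhang2014.IsKolyvaginPrime (W.conductorNorm ℤ) W K p ℓ}) (n : Finset (AdmQ W K p)) (μ : Bool), ℓ ∉ m → n.Nonempty →
      (∃ x ∈ Mix m n μ, ¬ (∀ v : HeightOneSpectrum (𝓞 K), ((ℓ : ℕ) : 𝓞 K) ∈ v.asIdeal →
        x ∈ (W.baseChange K).torsionLocalKer (v.adicCompletion K) ((p ^ 1 : ℕ) : ℤ))) ∨
      (∃ y ∈ Mix (insert ℓ m) n μ, ¬ (∀ v : HeightOneSpectrum (𝓞 K), ((ℓ : ℕ) : 𝓞 K) ∈ v.asIdeal →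
        y ∈ (W.baseChange K).torsionLocalKer (v.adicCompletion K) ((p ^ 1 : ℕ) : ℤ))) :=
  twinJump_mixed_of_trich W K p c ι hK hp2 hd hsurj hc hPT
    (fun m ℓ n v μ x _ hv hxs hxR hxK ↦
      mem_transverseLocalKerP_of_mixedRelaxed W K p c ι hK hp2 hd hsurj hc m ℓ n v μ x hv hxs hxR hxK)
    Mix hMix

/-- **(Twin), JUMP — instance-free form**: `twinJump_mixed_of_poitouTate` with the `ZMod p`-structures on the local `H¹(K_v, E[p])` supplied
in the kernel (`AddCommGroup.zmodModule`, the groups being `p`-torsion), so that a by-name capstone can call it with the frame data and the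
`[Module (ZMod p) (Vp W K p)]` binder of the route alone. [cite: WZhang2014, Lemma 8.2] [cite: Howard2004HeegnerKolyvagin, Lemma 2.5.3] -/
theorem twinJump_mixed_of_poitouTate'
    (hK : IsImaginaryQuadratic K) (hp2 : p ≠ 2) (hd : NumberField.discr K < -4)
    (hsurj : W.HasSurjectiveModNGaloisRep p) (hc : c ≠ 1) (hPT : poitouTate_selmerStructure_duality K)
    (Mix : Finset {ℓ // Zhang2014.IsKolyvaginPrime (W.conductorNorm ℤ) W K p ℓ} → Finset (AdmQ W K p) → Bool → Submodule (ZMod p) (Vp W K p))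
    (hMix : ∀ (m : Finset {ℓ // Zhang2014.IsKolyvaginPrime (W.conductorNorm ℤ) W K p ℓ}) (n : Finset (AdmQ W K p)) (μ : Bool) (x : Vp W K p),
      x ∈ Mix m n μ ↔ (conjAct W c ((p ^ 1 : ℕ) : ℤ) x = sgnP μ • x ∧
        (∀ w : InfinitePlace K, x ∈ selmerLocalKer (W.baseChange K) w.Completion ((p ^ 1 : ℕ) : ℤ)) ∧
        (∀ v : HeightOneSpectrum (𝓞 K), (∀ ℓ ∈ m, ((ℓ : ℕ) : 𝓞 K) ∉ v.asIdeal) → (∀ q ∈ n, ((q : ℕ) : 𝓞 K) ∉ v.asIdeal) →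
          x ∈ selmerLocalKer (W.baseChange K) (v.adicCompletion K) ((p ^ 1 : ℕ) : ℤ)) ∧
        (∀ q ∈ n, ∀ v : HeightOneSpectrum (𝓞 K), ((q : ℕ) : 𝓞 K) ∈ v.asIdeal →
          x ∈ toricLocalKer (W.baseChange K) (v.adicCompletion K) ((p ^ 1 : ℕ) : ℤ)) ∧
        (∀ ℓ ∈ m, ∀ v : HeightOneSpectrum (𝓞 K), ((ℓ : ℕ) : 𝓞 K) ∈ v.asIdeal → x ∈ transverseLocalKerP W K p ι ℓ v))) :
    ∀ (m : Finset {ℓ // Zhang2014.IsKolyvaginPrime (W.conductorNorm ℤ) W K p ℓ})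
      (ℓ : {ℓ // Zhang2014.IsKolyvaginPrime (W.conductorNorm ℤ) W K p ℓ}) (n : Finset (AdmQ W K p)) (μ : Bool), ℓ ∉ m → n.Nonempty →
      (∃ x ∈ Mix m n μ, ¬ (∀ v : HeightOneSpectrum (𝓞 K), ((ℓ : ℕ) : 𝓞 K) ∈ v.asIdeal →
        x ∈ (W.baseChange K).torsionLocalKer (v.adicCompletion K) ((p ^ 1 : ℕ) : ℤ))) ∨
      (∃ y ∈ Mix (insert ℓ m) n μ, ¬ (∀ v : HeightOneSpectrum (𝓞 K), ((ℓ : ℕ) : 𝓞 K) ∈ v.asIdeal →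
        y ∈ (W.baseChange K).torsionLocalKer (v.adicCompletion K) ((p ^ 1 : ℕ) : ℤ))) := by
  letI : ∀ v : Place K, Module (ZMod p)
      (galoisCohomology (((W.baseChange K).torsionGaloisModule ((p ^ 1 : ℕ) : ℤ)).toLocal v) 1) := fun v ↦
    AddCommGroup.zmodModule (fun x ↦ by
      have h := galoisCohomology.nsmul_eq_zero_of_forall
        (((W.baseChange K).torsionGaloisModule ((p ^ 1 : ℕ) : ℤ)).toLocal v) (n := p ^ 1)
        (fun m => AddSubgroup.torsionBy.nsmul m) x
      simpa using h)
  exact twinJump_mixed_of_poitouTate W K p c ι hK hp2 hd hsurj hc hPT Mix hMix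

end Summit.BirchSwinnertonDyer.BirchSwinnertonDyer.Theorems.AdditiveKoly

end
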